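import Summits.ResolutionOfSingularities.ResolutionOfSingularities.Theorems.PurelyInseparableDim4PhiLineLabelForm
import Literature.AlgebraicGeometry.Resolution.HironakaDirectrixPolarTame
import HarnessLib

/-!
# (K-Φ3) label propagation VI: EXISTENCE of the linear re-adaptation (the «2×2 linear solve» of CARD I-1-8)

Cell `res-dim4-pi` (D-0157 DOOR 2), Φ = β_h line of res-dim4-idea-1 (CARD I-1-8 «the carried critical label, preparation-free»,
`cards/idea-1.md` b3f9c12c40efe66b, claim C2 «LABEL + (2,0)-solvability»: «the entire residue of Hironaka preparation is ONE lattice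
point (2,0) per LOSE-h step, dissolved by a 2×2 LINEAR solve over 𝔽_p (forced by e′ = 2)»; memo §6.2 (P2)). FILE III
(`…PhiLineLabelForm`) proved: if NO monomial `Z^B U_i` occurs, the tangent form `Φ` is `U`-free. This file proves the EXISTENCE half
without that hypothesis: under (i) `|U| ≤ dim A(Φ)` and (ii) «the `U`-free part needs all `Z`-variables», for `Φ` of total degree
`< p = char K` (tame degree), there is a LINEAR substitution `Z_j ↦ Z_j − Σ_{i∈U} v_i(j) U_i` (the `v_i` supported on `Z`, unique) after
which `Φ` becomes its own `U`-free part — i.e. the frame `(z − Σ_i v_i u_i ; u)` is a label — and `v_i = 0` for every `i` without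
monomials `Z^B U_i` (so in I-1-8 only the `u₁`-component moves: the child-level form of the parent's `(2,0)`-dissolution).

* `dirShift_eq_C_of_polar_eq_zero` — tame degree + vanishing polar ⇒ `Φ(x + Tt) = Φ(x)` in `K[x][T]` (all directional Hasse
  derivatives vanish: `hasseD_eq_zero_of_polar_eq_zero'`, tree);
* **`aeval_add_mul_eq_aeval_of_mem_additiveSubspace`** — for `t ∈ A(Φ)` and ANY commutative `K`-algebra `A`, `y : σ → A`, `s : A`:
  `Φ(y + s·t) = Φ(y)` (evaluate `T ↦ s`, `x ↦ y`);
* `aeval_add_sum_mul_eq_aeval` — the same for `y + Σ_{i∈S} s_i t_i`, `t_i ∈ A(Φ)` (induction on `S`);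
* **`exists_linear_readaptation`** — (i)+(ii) ⇒ `∃ v`, `v i` supported off `U`, with
  `aeval (fun j => if j ∈ U then 0 else X j − Σ_{i∈U} C (v i j) * X i) Φ = Φ`, i.e. `Φ(Z, U) = F(Z − Σ_i v_i U_i)` with `F = Φ(Z, 0)`;
  and `v i = 0` whenever `Φ` has no monomial `Z^B U_i` (`eq_zero_of_no_cross_monomials`).

[OURS · counted 0 · AI work weaker than expert review.] Nothing here proves K2(p), the β_h line, or resolution of singularities in
dimension ≥ 4 / characteristic p.

Sources: H. Hironaka, Ann. of Math. 92 (1970), §1–2 (additive groups of translations) [`Hironaka1970AdditiveGroups`]; J. Berthomieu,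
P. Hivert, H. Mourtada (2010), §3.2, Cor. 2.3 [`BerthomieuHivertMourtada2010`]; V. Cossart, U. Jannsen, S. Saito, LNM **2270** (2020),
Def. 2.18/2.21, Lemma 12.2 (2) [`CossartJannsenSaito2020`]. Tree: `Literature/…/HironakaDirectrixPolarTame.lean`,
`WeightedCentreHasseSubspace.lean` (`dirShift`, `hasseD`).
-/

noncomputable section

open MvPolynomial Finset
open Literature.AlgebraicGeometry.Resolution (hasseD_eq_zero_of_polar_eq_zero')
open Literature.AlgebraicGeometry.Resolution.WeightedBlowup.HasseDir (dirShift hasseD hasseD_zero hasseD_def dirShift_X dirShift_C)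
open Literature.AlgebraicGeometry.Resolution.PointBlowup (additiveSubspace polarMap killVars)

set_option linter.dupNamespace false

namespace Summit.ResolutionOfSingularities.ResolutionOfSingularities.Theorems.PIDim4.PhiLine

variable {K : Type*} [Field K] {σ : Type*}

/-! ## Tame translation invariance along a direction of `A(Φ)` -/

/-- **Tame degree + vanishing polar ⇒ `Φ(x + Tt) = Φ(x)`** in `K[x][T]`. [cite: BerthomieuHivertMourtada2010, §3.2] -/
theorem dirShift_eq_C_of_polar_eq_zero [Fintype σ] {Φ : MvPolynomial σ K} {t : σ → K}
    (hchar : ∀ m : ℕ, 1 ≤ m → m ≤ Φ.totalDegree → (m : K) ≠ 0) (hpol : ∑ i, C (t i) * pderiv i Φ = 0) :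
    dirShift t Φ = Polynomial.C Φ := by
  refine Polynomial.ext fun n => ?_
  rcases Nat.eq_zero_or_pos n with rfl | hn
  · rw [Polynomial.coeff_C_zero, ← hasseD_def, hasseD_zero]
  · rw [Polynomial.coeff_C, if_neg hn.ne', ← hasseD_def]
    exact hasseD_eq_zero_of_polar_eq_zero' t hchar hpol n hn

/-- The hypothesis «`1, …, deg Φ` non-zero in `K`» from `deg Φ < p = char K`. [folklore] -/
theorem natCast_ne_zero_of_totalDegree_lt (p : ℕ) [CharP K p] {Φ : MvPolynomial σ K} (hΦ : Φ.totalDegree < p) :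
    ∀ m : ℕ, 1 ≤ m → m ≤ Φ.totalDegree → (m : K) ≠ 0 := by
  intro m h1 hm
  rw [Ne, CharP.cast_eq_zero_iff K p m]
  exact fun hdvd => absurd (Nat.le_of_dvd (by omega) hdvd) (by omega)

/-- **Translation invariance with polynomial parameter.** If `Φ(x + Tt) = Φ(x)` in `K[x][T]`, then for every commutative `K`-algebra `A`,
every `y : σ → A` and every `s : A`: `Φ(y + s·t) = Φ(y)`. [cite: Hironaka1970AdditiveGroups, §1] -/
theorem aeval_add_mul_eq_aeval_of_dirShift_eq {A : Type*} [CommRing A] [Algebra K A] {Φ : MvPolynomial σ K} {t : σ → K}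
    (hΦ : dirShift t Φ = Polynomial.C Φ) (y : σ → A) (s : A) :
    aeval (fun j => y j + algebraMap K A (t j) * s) Φ = aeval y Φ := by
  -- evaluate `x ↦ y`, `T ↦ s`
  have key : ∀ P : MvPolynomial σ K,
      Polynomial.eval₂ ((MvPolynomial.aeval y : MvPolynomial σ K →ₐ[K] A) : MvPolynomial σ K →+* A) s (dirShift t P) =
        aeval (fun j => y j + algebraMap K A (t j) * s) P := by
    intro P
    induction P using MvPolynomial.induction_on with
    | C a => rw [dirShift_C, Polynomial.eval₂_C, aeval_C, RingHom.coe_coe, aeval_C]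
    | add p q hp hq => rw [map_add, Polynomial.eval₂_add, hp, hq, map_add]
    | mul_X p i hp =>
      rw [map_mul, Polynomial.eval₂_mul, hp, dirShift_X, Polynomial.eval₂_add, Polynomial.eval₂_mul, Polynomial.eval₂_C,
        Polynomial.eval₂_C, Polynomial.eval₂_X, map_mul, aeval_X]
      simp only [RingHom.coe_coe, aeval_X, aeval_C]
  have h := key Φ
  rw [hΦ, Polynomial.eval₂_C, RingHom.coe_coe] at h
  exact h.symm

/-- **A direction of the additive subspace is a direction of translation invariance, with polynomial parameter** (tame degree
`deg Φ < p`): for `t ∈ A(Φ)`, every commutative `K`-algebra `A`, `y : σ → A`, `s : A`: `Φ(y + s·t) = Φ(y)`.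
[cite: Hironaka1970AdditiveGroups, §1] [cite: BerthomieuHivertMourtada2010, Cor. 2.3] -/
theorem aeval_add_mul_eq_aeval_of_mem_additiveSubspace [Fintype σ] [DecidableEq σ] (p : ℕ) [CharP K p] {Φ : MvPolynomial σ K}
    (hdeg : Φ.totalDegree < p) {t : σ → K} (ht : t ∈ additiveSubspace Φ) {A : Type*} [CommRing A] [Algebra K A] (y : σ → A) (s : A) :
    aeval (fun j => y j + algebraMap K A (t j) * s) Φ = aeval y Φ := by
  refine aeval_add_mul_eq_aeval_of_dirShift_eq (dirShift_eq_C_of_polar_eq_zero (natCast_ne_zero_of_totalDegree_lt p hdeg) ?_) y s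
  rw [mem_additiveSubspace_iff_sum_smul_pderiv] at ht
  rw [← ht]
  exact Finset.sum_congr rfl fun i _ => (smul_eq_C_mul _ _).symm

/-- Several directions at once: `Φ(y + Σ_{i∈S} s_i t_i) = Φ(y)` for `t_i ∈ A(Φ)` (tame degree). [cite: Hironaka1970AdditiveGroups, §1] -/
theorem aeval_add_sum_mul_eq_aeval [Fintype σ] [DecidableEq σ] (p : ℕ) [CharP K p] {Φ : MvPolynomial σ K} (hdeg : Φ.totalDegree < p)
    {ι : Type*} (S : Finset ι) {t : ι → σ → K} (ht : ∀ i ∈ S, t i ∈ additiveSubspace Φ) {A : Type*} [CommRing A] [Algebra K A]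
    (y : σ → A) (s : ι → A) :
    aeval (fun j => y j + ∑ i ∈ S, algebraMap K A (t i j) * s i) Φ = aeval y Φ := by
  classical
  induction S using Finset.induction_on with
  | empty => simp
  | insert a S haS ih =>
    have ht' : ∀ i ∈ S, t i ∈ additiveSubspace Φ := fun i hi => ht i (Finset.mem_insert_of_mem hi)
    have h1 := aeval_add_mul_eq_aeval_of_mem_additiveSubspace p hdeg (ht a (Finset.mem_insert_self a S))
      (fun j => y j + ∑ i ∈ S, algebraMap K A (t i j) * s i) (s a)
    have hfun : (fun j => y j + ∑ i ∈ insert a S, algebraMap K A (t i j) * s i) =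
        fun j => (y j + ∑ i ∈ S, algebraMap K A (t i j) * s i) + algebraMap K A (t a j) * s a := by
      funext j
      rw [Finset.sum_insert haS]
      ring
    rw [hfun, h1, ih ht']

/-! ## Existence (and partial vanishing) of the re-adaptation vectors -/

section Readapt

variable [Fintype σ] [DecidableEq σ] (U : Finset σ) (Φ : MvPolynomial σ K)

/-- Under (i) `|U| ≤ dim A(Φ)` and (ii) «the `U`-free part needs all `Z`-variables» (directrix form, as in FILE III), there are directions
`t_i = e_i + v_i ∈ A(Φ)` (`i ∈ U`) with `v_i` supported off `U`. [cite: CossartJannsenSaito2020, Def. 2.18] -/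
theorem exists_additive_directions (hT : U.card ≤ Module.finrank K (additiveSubspace Φ))
    (hF' : ∀ v ∈ additiveSubspace (killVars U Φ), (∀ i ∈ U, v i = 0) → v = 0) :
    ∃ v : σ → σ → K, (∀ i ∈ U, ∀ j ∈ U, v i j = 0) ∧ ∀ i ∈ U, (Pi.single i 1 + v i : σ → K) ∈ additiveSubspace Φ := by
  classical
  have hF := label_hypothesis_ii_of_additiveSubspace_killVars U Φ hF'
  have key : ∀ i ∈ U, ∃ w : σ → K, (∀ j ∈ U, w j = 0) ∧ (Pi.single i 1 + w : σ → K) ∈ additiveSubspace Φ := by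
    intro i hi
    obtain ⟨t, ht, htU⟩ := exists_mem_additiveSubspace_restrict_eq U Φ hT hF (fun j : U => if (j : σ) = i then 1 else 0)
    refine ⟨fun j => if j ∈ U then 0 else t j, fun j hj => by simp [hj], ?_⟩
    have heq : (Pi.single i 1 + fun j => if j ∈ U then 0 else t j : σ → K) = t := by
      funext j
      by_cases hj : j ∈ U
      · have := htU ⟨j, hj⟩
        simp only at this
        simp only [Pi.add_apply, hj, if_true, add_zero, Pi.single_apply, this]
      · have hji : j ≠ i := fun h => hj (h ▸ hi)
        simp [hj, hji]
    rw [heq]; exact ht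
  choose! w hwU hwA using key
  exact ⟨w, hwU, hwA⟩

/-- A direction `e_i + v_i ∈ A(Φ)` with `v_i` supported off `U` has `v_i = 0` as soon as `Φ` has no monomial `Z^B U_i`
(`ρ_U(∂_iΦ) = 0`), under (ii). [cite: CossartJannsenSaito2020, Lemma 12.2 (2)] -/
theorem eq_zero_of_no_cross_monomials (hF' : ∀ v ∈ additiveSubspace (killVars U Φ), (∀ i ∈ U, v i = 0) → v = 0)
    {i : σ} (h1 : killVars U (pderiv i Φ) = 0) {v : σ → K} (hvU : ∀ j ∈ U, v j = 0)
    (hv : (Pi.single i 1 + v : σ → K) ∈ additiveSubspace Φ) : v = 0 := by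
  classical
  have hsum : ∑ j, (Pi.single i 1 + v : σ → K) j • pderiv j Φ = pderiv i Φ + ∑ j, v j • pderiv j Φ := by
    simp only [Pi.add_apply, add_smul, Finset.sum_add_distrib]
    congr 1
    rw [Finset.sum_eq_single i (fun j _ hji => by rw [Pi.single_eq_of_ne hji, zero_smul])
      (fun h => absurd (Finset.mem_univ i) h), Pi.single_eq_same, one_smul]
  have hD : pderiv i Φ + ∑ j, v j • pderiv j Φ = 0 := by
    rw [← hsum]; exact (mem_additiveSubspace_iff_sum_smul_pderiv Φ _).mp hv
  refine hF' v ?_ hvU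
  rw [mem_additiveSubspace_iff_sum_smul_pderiv, ← killVars_sum_smul_pderiv U Φ hvU]
  have h := congrArg (killVars U) hD
  rw [map_add, h1, zero_add, map_zero] at h
  exact h

/-- **Existence of the linear re-adaptation (CARD I-1-8, C2).** Let `Φ` have total degree `< p = char K` and satisfy (i)
`|U| ≤ dim A(Φ)` and (ii) «`A(ρ_U Φ)` meets the `Z`-supported directions trivially». Then there are vectors `v_i` (`i ∈ U`) supported off
`U` such that `Φ(Z, U) = Φ(Z − Σ_{i∈U} v_i U_i, 0)`: after the linear change of the `Z`-coordinates `Z̃_j = Z_j − Σ_i v_i(j) U_i` the form is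
`U`-free (the frame `(z − Σ_i v_i u_i ; u)` is a LABEL); moreover `v_i = 0` for every `i ∈ U` without monomials `Z^B U_i`.
[cite: CossartJannsenSaito2020, Lemma 12.2 (2)] [cite: Hironaka1970AdditiveGroups, §1] -/
theorem exists_linear_readaptation (p : ℕ) [CharP K p] (hdeg : Φ.totalDegree < p) (hT : U.card ≤ Module.finrank K (additiveSubspace Φ))
    (hF' : ∀ v ∈ additiveSubspace (killVars U Φ), (∀ i ∈ U, v i = 0) → v = 0) :
    ∃ v : σ → σ → K, (∀ i ∈ U, ∀ j ∈ U, v i j = 0) ∧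
      aeval (fun j => if j ∈ U then (0 : MvPolynomial σ K) else X j - ∑ i ∈ U, C (v i j) * X i) Φ = Φ ∧
      ∀ i ∈ U, killVars U (pderiv i Φ) = 0 → v i = 0 := by
  classical
  obtain ⟨v, hvU, hvA⟩ := exists_additive_directions U Φ hT hF'
  refine ⟨v, hvU, ?_, fun i hi h1 => eq_zero_of_no_cross_monomials U Φ hF' h1 (hvU i hi) (hvA i hi)⟩
  have h := aeval_add_sum_mul_eq_aeval p hdeg U (t := fun i => (Pi.single i 1 + v i : σ → K)) hvA (A := MvPolynomial σ K) X
    (fun i => -X i)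
  have hfun : (fun j => X j + ∑ i ∈ U, algebraMap K (MvPolynomial σ K) ((Pi.single i 1 + v i : σ → K) j) * -X i) =
      fun j => if j ∈ U then (0 : MvPolynomial σ K) else X j - ∑ i ∈ U, C (v i j) * X i := by
    funext j
    by_cases hj : j ∈ U
    · rw [if_pos hj]
      have hterm : ∀ i ∈ U, algebraMap K (MvPolynomial σ K) ((Pi.single i 1 + v i : σ → K) j) * -X i =
          if i = j then -X j else 0 := by
        intro i hi
        rw [Pi.add_apply, hvU i hi j hj, add_zero]
        by_cases hij : i = j
        · subst hij; rw [Pi.single_eq_same, map_one, one_mul, if_pos rfl]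
        · rw [Pi.single_eq_of_ne' hij, map_zero, zero_mul, if_neg hij]
      rw [Finset.sum_congr rfl hterm, Finset.sum_ite_eq' U j (fun _ => -X j), if_pos hj]
      ring
    · rw [if_neg hj, sub_eq_add_neg, ← Finset.sum_neg_distrib]
      congr 1
      refine Finset.sum_congr rfl fun i hi => ?_
      have hij : i ≠ j := fun h => hj (h ▸ hi)
      rw [Pi.add_apply, Pi.single_eq_of_ne' hij, zero_add, algebraMap_eq]
      ring
  rw [hfun, aeval_X_left_apply] at h
  exact h

end Readapt

end Summit.ResolutionOfSingularities.ResolutionOfSingularities.Theorems.PIDim4.PhiLine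

end
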